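import Summits.CriticalPhenomena.PercolationContinuityZ3.Theorems.PercNearOneGluingNoHeavyQuantCornerTheorem
import HarnessLib

/-!
# QUANT lane R8, T-DEC: the flow form of DEC is MONOTONE in the law (less low mass, more absorber mass), ADDITIVE and HOMOGENEOUS;
# the corner certificate inherits the monotonicity

builds on p205010 (kernel theorem, internal audit signed; external expert review pending)

Support file (`--supports stmt-CriticalPhenomena-4575`), QUANT lane typer seat prim-quant-stmt (gen 23), rung R8 of
`run/shared/lean/prim/quant/LADDER.md`.  Theorems only; standard axioms, no sorries.  Small algebra of `LawDec.FlowAtT` / `LawDec.IsFlowAtT`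
(typer g22 p287960 / this seat p304437) for the comparison arguments of the slice programme (LEAD-NOTES-G21 N45 (6), G22 N48): at a FIXED
target `T`, floor `x` and layer `j′`,
* **`IsFlowAtT.mono_law`**, **`FlowAtT.mono_law`** — if `μ` is feasible and `μ′` has at most the mass of `μ` on every low atom
  (`0 ≤ μ′ l ≤ μ l` for `l ≤ j′`, `2l < T`) and at least the mass of `μ` on every absorber (`μ h ≤ μ′ h` for `h ≤ M` a giant or `T ≤ 2h`),
  then `μ′` is feasible (scale each row by `μ′ l / μ l`);
* `FlowAtT.smul` (`c ≥ 0`), **`FlowAtT.add`** — feasibility is a convex cone in the law (sum of witnesses);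
* **`cornerSucceeds_mono_law`** — the corner certificate is monotone in the same sense (through `cornerTheorem_holds`, p306129);
* `decAtT_mono_law` — the same for `DECAtT` between probability laws on `{0..M}`.
(Target monotonicity is typer g22's `decAtT_antitone_target`; top monotonicity `decAtT_mono_top`.)

[this work]; `…QuantLawDecFlows(Decomposition)` (typer g22), `…QuantCornerPrelims/CornerTheorem` (this seat).  Nothing here is cited as a
published result.  The gluing rows served [cite: KozmaNitzan2024, Conjecture 3 (p. 15)]; product measure [cite: Grimmett1999, §1.3 p. 10].
-/

noncomputable section

namespace Summit.CriticalPhenomena.PercolationContinuityZ3.Theorems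

namespace Quant

open Finset

namespace LawDec

/-! ### Monotonicity in the law -/

/-- **LESS LOW MASS, MORE ABSORBER MASS PRESERVES A WITNESS** (rows rescaled by `μ′ l / μ l`). [this work] -/
theorem IsFlowAtT.mono_law {x T : ℝ} {j' M : ℕ} {μ μ' : ℕ → ℝ} {f : ℕ → ℕ → ℝ} (hF : IsFlowAtT x T j' M μ f)
    (hx0 : 0 < x) (hx1 : x < 1)
    (hlow : ∀ l, l ≤ j' → 2 * (l : ℝ) < T → 0 ≤ μ' l ∧ μ' l ≤ μ l)
    (habs : ∀ h, h ≤ M → (j' + 1 ≤ h ∨ T ≤ 2 * (h : ℝ)) → μ h ≤ μ' h) :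
    IsFlowAtT x T j' M μ' (fun l h => f l h * (if μ l = 0 then 0 else μ' l / μ l)) := by
  have hterm := hF.term_nonneg hx0 hx1
  obtain ⟨hf0, hsupp, hrow, hcol⟩ := hF
  -- the row factor is in [0, 1] on lows
  have hr : ∀ l, l ≤ j' → 2 * (l : ℝ) < T →
      0 ≤ (if μ l = 0 then (0:ℝ) else μ' l / μ l) ∧ (if μ l = 0 then (0:ℝ) else μ' l / μ l) ≤ 1 := by
    intro l hlj hllow
    obtain ⟨h0', hle⟩ := hlow l hlj hllow
    have hμl : 0 ≤ μ l := by
      rw [← hrow l hlj hllow]; exact Finset.sum_nonneg (fun h _ => hf0 l h)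
    by_cases hz : μ l = 0
    · rw [if_pos hz]; exact ⟨le_rfl, zero_le_one⟩
    · have hpos : 0 < μ l := lt_of_le_of_ne hμl (Ne.symm hz)
      rw [if_neg hz]
      exact ⟨div_nonneg h0' hμl, (div_le_one hpos).2 hle⟩
  -- off the lows the flow vanishes, so the factor is irrelevant there
  have hfz : ∀ l h, ¬ (l ≤ j' ∧ 2 * (l : ℝ) < T) → f l h = 0 := by
    intro l h hn
    by_contra hne
    have hpos : 0 < f l h := lt_of_le_of_ne (hf0 l h) (Ne.symm hne)
    obtain ⟨h1, h2, -, -⟩ := hsupp l h hpos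
    exact hn ⟨h1, h2⟩
  refine ⟨?_, ?_, ?_, ?_⟩
  · intro l h
    dsimp only
    by_cases hl : l ≤ j' ∧ 2 * (l : ℝ) < T
    · exact mul_nonneg (hf0 l h) (hr l hl.1 hl.2).1
    · rw [hfz l h hl, zero_mul]
  · intro l h hpos
    dsimp only at hpos
    have hf : 0 < f l h := by
      by_contra hn
      have : f l h = 0 := le_antisymm (not_lt.1 hn) (hf0 l h)
      rw [this, zero_mul] at hpos
      exact lt_irrefl _ hpos
    exact hsupp l h hf
  · intro l hlj hllow
    dsimp only
    rw [← Finset.sum_mul, hrow l hlj hllow]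
    by_cases hz : μ l = 0
    · rw [if_pos hz, mul_zero]
      obtain ⟨h0', hle⟩ := hlow l hlj hllow
      rw [hz] at hle
      linarith
    · rw [if_neg hz]; field_simp
  · intro h hhM hself
    dsimp only
    refine le_trans ?_ ((hcol h hhM hself).trans (habs h hhM hself))
    refine Finset.sum_le_sum (fun l _ => ?_)
    by_cases hl : l ≤ j' ∧ 2 * (l : ℝ) < T
    · have := hr l hl.1 hl.2
      have ht := hterm l h
      calc usage x T j' l h * (f l h * (if μ l = 0 then (0:ℝ) else μ' l / μ l))
          = (usage x T j' l h * f l h) * (if μ l = 0 then (0:ℝ) else μ' l / μ l) := by ring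
        _ ≤ (usage x T j' l h * f l h) * 1 := mul_le_mul_of_nonneg_left this.2 ht
        _ = usage x T j' l h * f l h := mul_one _
    · rw [hfz l h hl]; simp

/-- **THE FLOW FORM IS MONOTONE IN THE LAW**: at a fixed target, floor and layer, removing mass from low atoms (keeping them `≥ 0`) and
adding mass to absorbers preserves `FlowAtT`. [this work] -/
theorem FlowAtT.mono_law {x T : ℝ} {j' M : ℕ} {μ μ' : ℕ → ℝ} (hF : FlowAtT x T j' M μ) (hx0 : 0 < x) (hx1 : x < 1)
    (hlow : ∀ l, l ≤ j' → 2 * (l : ℝ) < T → 0 ≤ μ' l ∧ μ' l ≤ μ l)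
    (habs : ∀ h, h ≤ M → (j' + 1 ≤ h ∨ T ≤ 2 * (h : ℝ)) → μ h ≤ μ' h) : FlowAtT x T j' M μ' := by
  obtain ⟨f, hf⟩ := (flowAtT_iff_exists_isFlowAtT x T j' M μ).1 hF
  exact ⟨_, hf.mono_law hx0 hx1 hlow habs⟩

/-! ### Cone structure -/

/-- scaling a feasible law by `c ≥ 0` keeps it feasible. [this work] -/
theorem FlowAtT.smul {x T : ℝ} {j' M : ℕ} {μ : ℕ → ℝ} (hF : FlowAtT x T j' M μ) (c : ℝ) (hc : 0 ≤ c) :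
    FlowAtT x T j' M (fun k => c * μ k) := by
  obtain ⟨f, hf0, hsupp, hrow, hcol⟩ := hF
  refine ⟨fun l h => c * f l h, fun l h => mul_nonneg hc (hf0 l h), ?_, ?_, ?_⟩
  · intro l h hpos
    dsimp only at hpos
    have hf : 0 < f l h := by
      by_contra hn
      have : f l h = 0 := le_antisymm (not_lt.1 hn) (hf0 l h)
      rw [this, mul_zero] at hpos
      exact lt_irrefl _ hpos
    exact hsupp l h hf
  · intro l hlj hllow
    rw [← Finset.mul_sum, hrow l hlj hllow]
  · intro h hhM hself
    have e : ∀ l, usage x T j' l h * (c * f l h) = c * (usage x T j' l h * f l h) := fun l => by ring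
    simp only [e]
    rw [← Finset.mul_sum]
    exact mul_le_mul_of_nonneg_left (hcol h hhM hself) hc

/-- **the sum of two feasible laws is feasible** (sum of witnesses). [this work] -/
theorem FlowAtT.add {x T : ℝ} {j' M : ℕ} {μ₁ μ₂ : ℕ → ℝ} (h₁ : FlowAtT x T j' M μ₁) (h₂ : FlowAtT x T j' M μ₂) :
    FlowAtT x T j' M (fun k => μ₁ k + μ₂ k) := by
  obtain ⟨f₁, hf₁0, hsupp₁, hrow₁, hcol₁⟩ := h₁
  obtain ⟨f₂, hf₂0, hsupp₂, hrow₂, hcol₂⟩ := h₂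
  refine ⟨fun l h => f₁ l h + f₂ l h, fun l h => add_nonneg (hf₁0 l h) (hf₂0 l h), ?_, ?_, ?_⟩
  · intro l h hpos
    by_cases hp : 0 < f₁ l h
    · exact hsupp₁ l h hp
    · have hz : f₁ l h = 0 := le_antisymm (not_lt.1 hp) (hf₁0 l h)
      have : 0 < f₂ l h := by dsimp only at hpos; rw [hz, zero_add] at hpos; exact hpos
      exact hsupp₂ l h this
  · intro l hlj hllow
    dsimp only
    rw [Finset.sum_add_distrib, hrow₁ l hlj hllow, hrow₂ l hlj hllow]
  · intro h hhM hself
    dsimp only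
    have e : ∀ l, usage x T j' l h * (f₁ l h + f₂ l h) = usage x T j' l h * f₁ l h + usage x T j' l h * f₂ l h :=
      fun l => by ring
    simp only [e, Finset.sum_add_distrib]
    exact add_le_add (hcol₁ h hhM hself) (hcol₂ h hhM hself)

/-! ### Consequences for the corner certificate and for DEC -/

/-- **THE CORNER CERTIFICATE IS MONOTONE IN THE LAW** (nonnegative laws, `0 < x < 1`): less low mass and more absorber mass preserve
`CornerSucceeds` — through the corner theorem. [this work] -/
theorem cornerSucceeds_mono_law (x T : ℝ) (j' M : ℕ) (μ μ' : ℕ → ℝ) (hx0 : 0 < x) (hx1 : x < 1)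
    (hμ : ∀ k, 0 ≤ μ k) (hμ' : ∀ k, 0 ≤ μ' k)
    (hlow : ∀ l, l ≤ j' → 2 * (l : ℝ) < T → μ' l ≤ μ l)
    (habs : ∀ h, h ≤ M → (j' + 1 ≤ h ∨ T ≤ 2 * (h : ℝ)) → μ h ≤ μ' h)
    (hC : CornerSucceeds x T j' M μ) : CornerSucceeds x T j' M μ' :=
  cornerSucceeds_of_flowAtT x T j' M μ' hx0 hx1 hμ'
    ((flowAtT_of_cornerSucceeds x T j' M μ hx0 hx1 hμ hC).mono_law hx0 hx1 (fun l hl hlow' => ⟨hμ' l, hlow l hl hlow'⟩) habs)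

/-- **DEC(j′) AT A FIXED TARGET IS MONOTONE IN THE LAW** between probability laws on `{0..M}`: less low mass, more absorber mass. [this work] -/
theorem decAtT_mono_law (x T : ℝ) (j' M : ℕ) (μ μ' : ℕ → ℝ) (hx0 : 0 < x) (hx1 : x < 1)
    (hμ'M : ∀ h, M < h → μ' h = 0) (hμ'1 : ∑ h ∈ Finset.range (M + 1), μ' h = 1)
    (hlow : ∀ l, l ≤ j' → 2 * (l : ℝ) < T → 0 ≤ μ' l ∧ μ' l ≤ μ l)
    (habs : ∀ h, h ≤ M → (j' + 1 ≤ h ∨ T ≤ 2 * (h : ℝ)) → μ h ≤ μ' h)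
    (hD : DECAtT x T j' M μ) : DECAtT x T j' M μ' :=
  decAtT_of_flowAtT x T j' M μ' hx0 hx1 hμ'M hμ'1
    ((flowAtT_of_decAtT x T j' M μ hx0 hx1 hD).mono_law hx0 hx1 hlow habs)

end LawDec

end Quant

end Summit.CriticalPhenomena.PercolationContinuityZ3.Theorems
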